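import Literature.Barriers.PneNP.Relativization
import Literature.Barriers.QuantumAdvantage.Relativization
import Literature.Computability.Cryptography.ClassBQP
import Literature.Computability.Cryptography.SamplingProblems
import Literature.Computability.Cryptography.StatisticalDistance
import Literature.Computability.Cryptography.OracleGames
import Literature.Computability.Complexity.Oracle
import Literature.Computability.Complexity.PolyHierarchy
import Literature.Computability.Complexity.Nondeterministic
import Literature.Computability.Complexity.Classes
import HarnessLib

/-!
# Barrier catalogue `QuantumAdvantage`: strong quantum-supremacy theorems and "one-way functions ⟹ `BPP ≠ BQP`" must be non-relativizing (Fortnow–Rogers 1999; Aaronson–Chen 2017)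

D-0021 barrier entry for the summit `QuantumAdvantage`
(`Summits/QuantumAdvantage/QuantumAdvantage/Statement.lean`:
`QuantumAdvantage := ∃ L, L ∈ BQP ∧ L ∉ BPP`), bearing on the two standard forms of EVIDENCE
for the summit: conditional separations from a collapse of the polynomial hierarchy ("if
quantum computation were classically easy, `PH` would collapse", the Aaronson–Arkhipov /
Bremner–Jozsa–Shepherd programme for sampling problems) and conditional separations from
cryptographic assumptions ("one-way functions exist ⟹ `BPP ≠ BQP`").

**The printed results** (held arXiv copies; arXiv numbering).

* L. Fortnow, J. Rogers, *Complexity limitations on quantum computation*, JCSS 59 (1999)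
  240–252 (arXiv:cs/9811023) [FortnowRogers1999JCSS]. Cor. 3.7: "There exists a relativized
  world where `P = BQP` and the polynomial-time hierarchy is infinite." Thm. 4.1: "There is an
  oracle `C` relative to which one-way functions exist and `P^C = BQP^C`. Thus, to demonstrate
  that the existence of one-way functions implies a separation between `BPP` and `BQP` will
  require nonrelativizing techniques." Thm. 4.2: "There is an oracle `C` relative to which
  `P^C = BPP^C = BQP^C ≠ UP^C ∩ coUP^C`." (§1, p. 2: "Showing the containment [`BPP ⊆ BQP`]
  strict would require separating `BPP` and `PSPACE`".)
* S. Aaronson, L. Chen, *Complexity-theoretic foundations of quantum supremacy experiments*,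
  CCC 2017 (arXiv:1612.05903) [AaronsonChen2017]. Cor. 5.2: "There exists an oracle
  `O' = TQBF ⊕ O` such that `SampBPP^{O'} = SampBQP^{O'}` and `PH^{O'}` is infinite." §1
  (p. 2, p. 8): "any strong quantum supremacy theorem—of the form 'if approximate quantum
  sampling is classically easy, then the polynomial hierarchy collapses'—must be
  non-relativizing. This sharply contrasts with the situation for exact sampling"; "this is the
  first time we have explicit confirmation that non-relativizing techniques will be needed."
  Def. 2.3 (sampling problems, `SampBPP`, `SampBQP`; "oracle versions of these classes can also
  be defined in the natural way") and §2.2 (canonical form of a `SampBQP` oracle algorithm: an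
  oracle-free classical routine outputs, on `⟨x, 0^{1/ε}⟩`, a polynomial-size circuit with oracle
  gates, run on `|0…0⟩`, all qubits measured, an oracle-free classical routine post-processes the
  outcome).

**What this file adds.** The relativized sampling classes `SampPRel O` (= `SampBPP^O`) and
`SampBQPRel A` in the tree's models (C4a `OracleAdversary`; Q2 uniform Clifford+T families with
XOR-query oracle gates plus poly-time post-processing, exactly the unrelativized `SampBQP` of
`SamplingProblems.lean` with `kernel A` for `kernel 0`), the unambiguous classes `UPRel`,
`coUPRel` (`polyExistsUnique`), `IsInfinitePHRel`; the three printed oracle facts AS PRINTED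
(equalities): `fortnowRogers1999_cor37`, `fortnowRogers1999_thm42`, `aaronsonChen2017_cor52`; the
barrier decl `SupremacyTheoremsNonRelativizing` (their conjunction) with the D-0021 block; and
the no-go theorems PROVED from the facts over the tree's technique class
`Literature.Barriers.PneNP.Relativizes`: the templates `BQP^O ⊆ BPP^O ⟹ PH^O collapses`,
`SampBQP^O ⊆ SampBPP^O ⟹ PH^O collapses` and `P^O ≠ UP^O ∩ coUP^O ⟹ BQP^O ⊄ BPP^O` all fail
to relativize (`not_relativizes_collapse_template`, `not_relativizes_sampling_collapse_template`,
`not_relativizes_owf_template`; hypothesis-free `…summary_canonical`).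
Revision 2 (review follow-up of p9403): sibling import, `PresentsBQPRel`/`PresentsSampBQPRel`,
`sampBQPRelOf`, `SampPRel_empty`, `UP`/`coUP` anchors (`UP_eq_polyExistsUnique`, `UPRel_empty`).
Revision 3 (verdict clean-up 2026-08-16): the bridge fact `SampPRel_empty` — false as formalised,
refuted in the tree — becomes a `@[deprecated]` tombstone (Design notes, second item); no statement
of this file changed.

## Design notes

* `BQPRel`/`SampBQPRel` are indexed by the oracle LANGUAGE `A` (Q2's oracle gate is the XOR
  query to `A`), the classical classes by G01's function oracle; the bridge is
  `Oracle.ofLanguage`, and oracle-indexed presentations `C` of the quantum classes enter the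
  `Relativizes` statements through the sibling entry's `PresentsBQPRel C`
  (`∀ A, C (Oracle.ofLanguage A) = BQPRel A`, `Relativization.lean`; the convention of
  `AlgebrizationBarriers.lean`) resp. `PresentsSampBQPRel S` (defined here), both inhabited
  (`bqpRelOf`, `sampBQPRelOf`), so `SupremacyTheoremsNonRelativizing.summary_canonical` carries
  no presentation hypothesis.
* `SampPRel Oracle.empty = SampP` is NOT definitional — and it is FALSE over the tree's
  definitions: the tree's `SampP` is over `RandAlg` (G01 `Randomized.lean`) with `IsPPT A id`,
  which only *bounds* the coin budget `A.coinLen : ℕ → ℕ` (otherwise arbitrary data, readable by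
  `A.run` off the length of its coin string — advice), so `SampP` is uncountable
  (`Literature.Computability.Cryptography.not_countable_sampP`, `SamplingProblemsCardinality.lean`),
  whereas `SampPRel O`, over C4a `OracleAdversary` (LITERAL polynomials `coins`, `fuel` and a
  polynomial-time step function — uniform machines), is countable for every `O`
  (`sampPRel_countable`, sibling `SupremacyTheoremsNonRelativizingSampPRel.lean`). The
  identification was vendored in revision 2 as the (then "plausible") model-bridging named fact
  `SampPRel_empty` ([folklore], used nowhere); it is REFUTED in the tree
  (`not_SampPRel_empty : ¬ SampPRel_empty`, same sibling, p39128), and its faithful form —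
  Aaronson–Chen's `SampBPP` is a class of UNIFORM machines ("there exists a probabilistic
  polynomial-time algorithm `B` that, given `⟨x, 0^{1/ε}⟩` as input, samples from a probability
  distribution `𝒞_x` such that `‖𝒞_x − 𝒟_x‖ ≤ ε`", Def. 2.3, p. 12) — is
  `SampPRel_empty_uniform : SampPRel Oracle.empty = UniformSampP` over the tree's uniform class
  `Literature.Computability.Cryptography.UniformSampP` (`SamplingProblemsUniform.lean`), vendored
  and PROVED in the sibling `SupremacyTheoremsNonRelativizingSampPRelUniform.lean`
  (`SampPRel_empty_uniform_holds`, p39228; corollary `SampPRel_empty_subset_SampP`, the true half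
  of the refuted equality). **Verdict clean-up (2026-08-16):** `SampPRel_empty` can never be
  discharged and is no longer literature debt; it is kept, statement byte-for-byte, as a
  `@[deprecated]` tombstone only because its refutation names it (both siblings import this file,
  so the attribute names the replacement in its message, not as an identifier).
* `UP^O := polyExistsUnique (P^O)`; the tree's unrelativized `UP`, `coUP`
  (`Nondeterministic.lean`) are `polyExistsUnique P`, `co (polyExistsUnique P)` by `rfl`
  (`UP_eq_polyExistsUnique`, `coUP_eq`), and `UPRel ∅ = UP` follows from `PRel_empty`
  (`UPRel_empty`).
* `SampPRel`: a C4a oracle adversary outputs `Option (List Bool)` (`none` = no output within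
  the round budget); `none` is read as the empty string (junk value, harmless: a sampler may
  output `[]` anyway). Accuracy convention as in the tree's `SampP`: input `⟨x, 1^k⟩`
  (`boolPair x (unaryEncodeNat k)`), total variation `≤ 1/k`, `k ≥ 1` (AC17's `⟨x, 0^{1/ε}⟩`,
  `‖𝒞_x − 𝒟_x‖ ≤ ε`).
* "PH^O is infinite" is rendered as `∀ k, Σₖ^O ≠ Σₖ₊₁^O` (`IsInfinitePHRel`).
* Fortnow–Rogers' one-way functions are worst-case ("one-to-one, honest, polynomial-time
  computable function whose inverse is not polynomial-time computable", §1), whose existence is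
  equivalent to `P ≠ UP` (Grollmann–Selman); Thm. 4.2's printed `P^C ≠ UP^C ∩ coUP^C` is what is
  typed.

## Sources

* [FortnowRogers1999JCSS] arXiv:cs/9811023 (read via `lit read arxiv:cs/9811023`): §1 p. 2,
  Cor. 3.7 (p. 5), Thm. 4.1, Thm. 4.2 (p. 7), Thm. 4.4 (p. 7).
* [AaronsonChen2017] arXiv:1612.05903 (read via `lit read arxiv:1612.05903`): abstract/§1
  (p. 2, p. 8, p. 11), Def. 2.3 and §2.2 (p. 12), Thm. 5.1, Cor. 5.2 (p. 21), Thm. 7.6 (p. 30),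
  Thm. 8.1 (p. 32).
* [AroraBarakCC2009] §3.4, Thm. 3.7 p. 74 (relativizing results), as used in
  `Literature/Barriers/PneNP/Relativization.lean`.
-/

noncomputable section

namespace Literature.Barriers.QuantumAdvantage

open _root_.Computability Literature.Computability.Complexity Literature.Computability.Complexity.Classes Literature.Computability.Cryptography PneNP

/-! ### Relativized sampling classes -/

/-- `SampPRel O = SampBPP^O`: sampling problems `D` for which some probabilistic polynomial-time
oracle algorithm (C4a `OracleAdversary` over strings) with oracle `O`, on input `⟨x, 1^k⟩`
(`k ≥ 1`), outputs a sample from a distribution within total variation distance `1/k` of `D_x`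
(`none`, i.e. no output within the round budget, read as `[]`). The `O`-relativization of the
tree's `SampP` "in the natural way". [cite: AaronsonChen2017, Def. 2.3 (SampBPP; oracle versions)] -/
def SampPRel (O : Oracle) : Set SamplingProblem :=
  {D | ∃ 𝒜 : OracleAdversary (List Bool), 𝒜.IsPPT (encodingList Bool) ∧
    ∀ (x : List Bool) (k : ℕ), 0 < k →
      (PMF.map (fun o => o.getD []) (𝒜.outputPMF O (boolPair x (unaryEncodeNat k)))).tvDist
          (D x) ≤ 1 / (k : ℝ)}

/-- `SampBQPRel A = SampBQP^A`: sampling problems `D` for which some poly-time uniform family of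
Clifford+T circuits with oracle gates (XOR queries to the language `A`), run on `|⟨x, 1^k⟩⟩|0…0⟩`
and measured on all wires, followed by a deterministic polynomial-time oracle-free
post-processing `post`, outputs a sample within total variation `1/k` of `D_x` (`k ≥ 1`) —
Aaronson–Chen's canonical form of a `SampBQP` oracle algorithm; literally the tree's `SampBQP`
(`SamplingProblems.lean`) with `F.kernel A` in place of `F.kernel 0` and oracle gates allowed.
[cite: AaronsonChen2017, Def. 2.3 and §2.2 (canonical form of SampBQP oracle algorithms)] -/
def SampBQPRel (A : Language Bool) : Set SamplingProblem :=
  {D | ∃ (F : QCircuitFamily cliffordT) (post : List Bool → List Bool),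
    F.IsUniform ∧
    PolyTimeComputable (id : List Bool → List Bool) (id : List Bool → List Bool) post ∧
    ∀ (x : List Bool) (k : ℕ), 0 < k →
      ((F.kernel A (boolPair x (unaryEncodeNat k))).map post).tvDist (D x) ≤ 1 / (k : ℝ)}

/-- Unrelativized `SampBQP` is contained in `SampBQP^0` (an oracle-free family is a family; with
the empty oracle language its kernel is `kernel 0`). [cite: AaronsonChen2017, Def. 2.3] -/
theorem SampBQP_subset_SampBQPRel_zero : SampBQP ⊆ SampBQPRel 0 := by
  rintro D ⟨F, post, -, hU, hpost, h⟩
  exact ⟨F, post, hU, hpost, fun x k hk => h x k hk⟩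

/-- **REFUTED as formalised — `@[deprecated]` tombstone (verdict clean-up 2026-08-16); kept,
statement byte-for-byte, only because its refutation names it. Not literature debt: no
`SampPRel_empty_holds` can exist.**
*Original content.* `SampP^∅ = SampP`: relativizing the sampling class to the empty oracle gives
back the tree's `SampP` (model bridge between C4a oracle adversaries with a useless oracle and G01
randomized algorithms; not definitional), vendored as "plausible" and used nowhere.
**What is wrong.** The tree's `SampP` (`Cryptography/SamplingProblems.lean`) quantifies over
`RandAlg`s with `IsPPT A id`, which only *bounds* the coin budget `A.coinLen : ℕ → ℕ` — advice read
off the coin count — and is therefore uncountable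
(`Literature.Computability.Cryptography.not_countable_sampP`), whereas `SampPRel Oracle.empty` is a
class of uniform machines and countable (`sampPRel_countable`).
**Refutation (kernel-checked, kept):**
`Literature.Barriers.QuantumAdvantage.not_SampPRel_empty : ¬ SampPRel_empty`
(`SupremacyTheoremsNonRelativizingSampPRel.lean`).
**Use instead** the corrected bridge
`Literature.Barriers.QuantumAdvantage.SampPRel_empty_uniform : SampPRel Oracle.empty = UniformSampP`
— the uniform class is what the source describes ("a probabilistic polynomial-time algorithm `B`";
"Oracle versions of these classes can also be defined in the natural way", Aaronson–Chen 2017,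
Def. 2.3, p. 12) — PROVED (`SampPRel_empty_uniform_holds`,
`SupremacyTheoremsNonRelativizingSampPRelUniform.lean`), whose corollary
`SampPRel_empty_subset_SampP` is the true half of the present equality. [folklore] -/
@[deprecated "refuted as formalised: see Literature.Barriers.QuantumAdvantage.not_SampPRel_empty \
  (SupremacyTheoremsNonRelativizingSampPRel.lean); corrected statement: \
  Literature.Barriers.QuantumAdvantage.SampPRel_empty_uniform (SampPRel Oracle.empty = UniformSampP; \
  proved: SampPRel_empty_uniform_holds, SupremacyTheoremsNonRelativizingSampPRelUniform.lean)"
  (since := "2026-08-16")]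
def SampPRel_empty : Prop :=
  SampPRel Oracle.empty = SampP

/-- `PresentsSampBQPRel S`: the oracle-indexed class `S` of sampling problems agrees with
`SampBQPRel` on language oracles (the sampling analogue of the sibling entry's
`PresentsBQPRel`). [folklore] -/
def PresentsSampBQPRel (S : Oracle → Set SamplingProblem) : Prop :=
  ∀ A : Language Bool, S (Oracle.ofLanguage A) = SampBQPRel A

/-- The canonical presentation `O ↦ SampBQP^{oracleLanguage O}` (`oracleLanguage` from the
sibling entry reads the oracle's one-bit answers back as a language). [folklore] -/
def sampBQPRelOf (O : Oracle) : Set SamplingProblem :=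
  SampBQPRel (oracleLanguage O)

/-- The canonical presentation agrees with `SampBQPRel` on language oracles. [folklore] -/
theorem presentsSampBQPRel_sampBQPRelOf : PresentsSampBQPRel sampBQPRelOf :=
  fun A => by simp [sampBQPRelOf]

/-! ### Unambiguous polynomial time relative to an oracle -/

/-- The unique-witness operator: `L ∈ polyExistsUnique C` iff there are `L' ∈ C` and a
polynomial `p` with `x ∈ L ↔ ∃ y, |y| ≤ p |x| ∧ boolPair x y ∈ L'` AND for every `x` at most one
such `y` exists (Valiant's `UP = polyExistsUnique P`; compare the tree's `polyExists`).
[cite: FortnowRogers1999JCSS, §4 (UP ∩ coUP, arXiv numbering)] -/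
def polyExistsUnique (C : Set (Language Bool)) : Set (Language Bool) :=
  {L | ∃ L' ∈ C, ∃ p : Polynomial ℕ,
    (∀ x : List Bool, x ∈ L ↔ ∃ y : List Bool, y.length ≤ p.eval x.length ∧ boolPair x y ∈ L') ∧
    ∀ x : List Bool, {y : List Bool | y.length ≤ p.eval x.length ∧ boolPair x y ∈ L'}.Subsingleton}

/-- Unique witnesses are witnesses: `polyExistsUnique C ⊆ polyExists C` (`UP ⊆ NP`). [folklore] -/
theorem polyExistsUnique_subset_polyExists (C : Set (Language Bool)) :
    polyExistsUnique C ⊆ polyExists C := by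
  rintro L ⟨L', hL', p, h, -⟩
  exact ⟨L', hL', p, h⟩

/-- `UPRel O = UP^O := polyExistsUnique (P^O)`. [cite: FortnowRogers1999JCSS, Thm. 4.2 (arXiv numbering)] -/
def UPRel (O : Oracle) : Set (Language Bool) :=
  polyExistsUnique (PRel O)

/-- `coUPRel O = coUP^O := co (UP^O)`. [cite: FortnowRogers1999JCSS, Thm. 4.2 (arXiv numbering)] -/
def coUPRel (O : Oracle) : Set (Language Bool) :=
  co (UPRel O)

/-- `UP^O ⊆ NP^O`. [folklore] -/
theorem UPRel_subset_NPRel (O : Oracle) : UPRel O ⊆ NPRel O :=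
  polyExistsUnique_subset_polyExists _

/-- The tree's `UP` (`Nondeterministic.lean`) is `polyExistsUnique P`, definitionally. [folklore] -/
theorem UP_eq_polyExistsUnique : UP = polyExistsUnique P :=
  rfl

/-- The tree's `coUP` is `co (polyExistsUnique P)`, definitionally. [folklore] -/
theorem coUP_eq : coUP = co (polyExistsUnique P) :=
  rfl

/-- `UP^∅ = UP`, from the tree fact `PRel_empty : P^∅ = P`. [folklore] -/
theorem UPRel_empty (hE : PRel_empty) : UPRel Oracle.empty = UP := by
  change polyExistsUnique (PRel Oracle.empty) = UP
  rw [show PRel Oracle.empty = P from hE]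
  rfl

/-- `coUP^∅ = coUP`. [folklore] -/
theorem coUPRel_empty (hE : PRel_empty) : coUPRel Oracle.empty = coUP := by
  change co (UPRel Oracle.empty) = coUP
  rw [UPRel_empty hE]
  rfl

/-! ### "The polynomial hierarchy is infinite relative to `O`" -/

/-- `PH^O` is infinite: no two consecutive levels coincide, `Σₖ^O ≠ Σₖ₊₁^O` for every `k`.
[cite: AaronsonChen2017, §5 (PH^O is infinite)] [cite: FortnowRogers1999JCSS, Cor. 3.7 (arXiv numbering)] -/
def IsInfinitePHRel (O : Oracle) : Prop :=
  ∀ k : ℕ, SigmaPRel O k ≠ SigmaPRel O (k + 1)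

/-- An infinite hierarchy does not collapse to any finite level: `Σₖ^O ≠ PH^O` for all `k`,
granted the level inclusions `Σₖ^O ⊆ Σₖ₊₁^O` (hypothesis; the tree states the unrelativized
`SigmaP_subset_succ` as a named fact). [folklore] -/
theorem IsInfinitePHRel.sigma_ne_PHRel {O : Oracle} (h : IsInfinitePHRel O)
    (hmono : ∀ k, SigmaPRel O k ⊆ SigmaPRel O (k + 1)) (k : ℕ) : SigmaPRel O k ≠ PHRel O := by
  intro hk
  refine h k (Set.Subset.antisymm (hmono k) ?_)
  rw [hk]
  exact SigmaPRel_subset_PHRel O (k + 1)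

/-! ### The printed oracle facts -/

/-- **Fortnow–Rogers 1999, Cor. 3.7** (arXiv numbering): "There exists a relativized world where
`P = BQP` and the polynomial-time hierarchy is infinite" (a `PSPACE`-complete set joined with a
generic oracle; `BQP ⊆ AWPP` relativizes and `AWPP` collapses to `P` there).
[cite: FortnowRogers1999JCSS, Cor. 3.7 (arXiv numbering)] -/
def fortnowRogers1999_cor37 : Prop :=
  ∃ A : Language Bool, PRel (Oracle.ofLanguage A) = BQPRel A ∧ IsInfinitePHRel (Oracle.ofLanguage A)

/-- **Fortnow–Rogers 1999, Thm. 4.2** (arXiv numbering): "There is an oracle `C` relative to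
which `P^C = BPP^C = BQP^C ≠ UP^C ∩ coUP^C`" — so one-way functions (worst-case, `P ≠ UP`) exist
relative to `C` while `P^C = BQP^C` (Thm. 4.1). [cite: FortnowRogers1999JCSS, Thm. 4.2 and Thm. 4.1 (arXiv numbering)] -/
def fortnowRogers1999_thm42 : Prop :=
  ∃ C : Language Bool,
    PRel (Oracle.ofLanguage C) = BPPRel (Oracle.ofLanguage C) ∧
      BPPRel (Oracle.ofLanguage C) = BQPRel C ∧
        PRel (Oracle.ofLanguage C) ≠ UPRel (Oracle.ofLanguage C) ∩ coUPRel (Oracle.ofLanguage C)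

/-- **Aaronson–Chen 2017, Cor. 5.2**: "There exists an oracle `O' = TQBF ⊕ O` such that
`SampBPP^{O'} = SampBQP^{O'}` and `PH^{O'}` is infinite." [cite: AaronsonChen2017, Cor. 5.2 (with Thm. 5.1)] -/
def aaronsonChen2017_cor52 : Prop :=
  ∃ O : Language Bool,
    SampPRel (Oracle.ofLanguage O) = SampBQPRel O ∧ IsInfinitePHRel (Oracle.ofLanguage O)

/-! ### The barrier -/

/-- **Strong quantum-supremacy theorems and "one-way functions ⟹ `BPP ≠ BQP`" must be
non-relativizing** (Fortnow–Rogers 1999, Cor. 3.7, Thm. 4.1/4.2; Aaronson–Chen 2017, Cor. 5.2):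
the conjunction of the three printed oracle facts. The no-go theorems below derive, over the
tree's technique class `Literature.Barriers.PneNP.Relativizes`, that none of the three proof templates
relativizes.

BARRIER
technique_class: relativizing, oracle-independent, black-box, PH-collapse arguments, Stockmeyer approximate counting, supremacy theorems, one-way-function hypotheses
blocks: relativizing proofs of the three standard routes to EVIDENCE for the summit `QuantumAdvantage`: (a) "if `BQP ⊆ BPP` then `PH` collapses" — fails relative to an oracle with `P = BQP` and `PH` infinite (`fortnowRogers1999_cor37`; proved no-go `not_relativizes_collapse_template`) [cite: FortnowRogers1999JCSS, Cor. 3.7 (arXiv numbering)]; (b) the strong supremacy theorem sought by Aaronson–Arkhipov and Bremner–Montanaro–Shepherd, "if `SampBQP ⊆ SampBPP` (approximate sampling) then `PH` collapses" — fails relative to `O' = TQBF ⊕ O` (`aaronsonChen2017_cor52`; `not_relativizes_sampling_collapse_template`), so "any strong quantum supremacy theorem … must be non-relativizing" [cite: AaronsonChen2017, Cor. 5.2 and §1 (p. 2, p. 8)]; (c) "one-way functions exist ⟹ `BPP ≠ BQP`" (Simon's question) — fails relative to `C` with `P^C = BPP^C = BQP^C ≠ UP^C ∩ coUP^C` (`fortnowRogers1999_thm42`;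 `not_relativizes_owf_template`): "to demonstrate that the existence of one-way functions implies a separation between BPP and BQP will require nonrelativizing techniques" [cite: FortnowRogers1999JCSS, Thm. 4.1 and Thm. 4.2 (arXiv numbering)].
because: a relativizing argument holds relative to every oracle (`Relativizes`; Arora–Barak §3.4) [cite: AroraBarakCC2009, §3.4 and Thm. 3.7, p. 74]; Fortnow–Rogers join a `PSPACE`-complete set (collapsing `P = BPP = BQP`, since `BQP ⊆ AWPP` relativizes) with a generic oracle, relative to which `PH` stays infinite and `UP ∩ coUP` escapes `P` while a `BQP` machine's acceptance is insensitive to the single far-away generic string (BBBV hybrid bound) [cite: FortnowRogers1999JCSS, §3 (Cor. 3.7) and §4 (proof of Thm. 4.2, Thm. 4.3) (arXiv numbering)]; Aaronson–Chen hide a random string inside ORs of oracle bits — recoverable by `PH` (so `PH^{TQBF,O}` is infinite, via Rossman–Servedio–Tan) but invisible to polynomially many quantum queries even with a lucky input, so every `SampBQP^{TQBF,O}` algorithm is simulated in `SampBPP^{TQBF,O}` with probability `1` over `O` [cite: AaronsonChen2017, §5.1–5.3 (Thm. 5.1, Lemma 5.3)].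
evasions_known: for EXACT (or multiplicative-error) sampling the collapse "`SampBPP = SampBQP` exactly ⟹ `PH` collapses" IS provable and relativizes (Stockmeyer counting + `PostBQP = PP` + Toda), which is why the barrier is specific to approximate sampling [cite: AaronsonChen2017, §1 (p. 2, p. 8: "sharply contrasts with the situation for exact sampling")]; non-relativizing ingredients were the original motivation for BosonSampling ("exploit the famous non-relativizing properties of the permanent") [cite: AaronsonChen2017, §1 p. 8]; non-black-box assumptions: with oracles in `P/poly`, one-way functions DO give `BPP^O ≠ BQP^O` for some `O ∈ P/poly` [cite: AaronsonChen2017, Thm. 7.6], while unconditional such separations would need `SampBPP ≠ SampBQP` or `NP ⊄ BPP` anyway [cite: AaronsonChen2017, Thm. 8.1]; Fortnow–Rogers: if `P = BQP` relative to a random oracle then `BQP = BPP` unrelativized, so random-oracle collapses would transfer [cite: FortnowRogers1999JCSS, Thm. 4.4 (arXiv numbering)].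
scope_caveats: the formal content is exactly the three oracle-existence facts and `¬ Relativizes Φ` for the three templates; "must be non-relativizing" is the informal reading [cite: AroraBarakCC2009, §3.4.1 pp. 75–76]; models: `BQPRel`/`SampBQPRel` = uniform Clifford+T families with XOR-query gates to a language (Aaronson–Chen's canonical form has the circuit depend on `x`, equivalent for uniform families fed `|x⟩`), `SampPRel` = C4a transcript adversaries with `none ↦ []`, `PRel`/`BPPRel`/`SigmaPRel` = G01 transcript model, all adequate for language oracles only; "`PH` infinite" = `∀ k, Σₖ^O ≠ Σₖ₊₁^O`; Fortnow–Rogers' one-way functions are worst-case (`P ≠ UP`), not the cryptographic (average-case) ones — they leave "whether there exists a relativized world where `BPP = BQP` and cryptographic one-way functions exist" OPEN [cite: FortnowRogers1999JCSS, §4 (after Thm. 4.3) (arXiv numbering)]; nothing here concerns proofs of the summit itself from `PH` assumptions in the unrelativized world, only the relativizing ones.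
status: established (theorems in print; oracle facts vendored as named facts, the no-go readings proved here) [cite: FortnowRogers1999JCSS, Cor. 3.7, Thm. 4.2 (arXiv numbering)] [cite: AaronsonChen2017, Cor. 5.2] -/
def SupremacyTheoremsNonRelativizing : Prop :=
  fortnowRogers1999_cor37 ∧ fortnowRogers1999_thm42 ∧ aaronsonChen2017_cor52

/-- Projection: the Fortnow–Rogers collapse-with-infinite-`PH` oracle. [cite: FortnowRogers1999JCSS, Cor. 3.7 (arXiv numbering)] -/
theorem SupremacyTheoremsNonRelativizing.cor37 (h : SupremacyTheoremsNonRelativizing) :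
    fortnowRogers1999_cor37 :=
  h.1

/-- Projection: the Fortnow–Rogers one-way-function oracle. [cite: FortnowRogers1999JCSS, Thm. 4.2 (arXiv numbering)] -/
theorem SupremacyTheoremsNonRelativizing.thm42 (h : SupremacyTheoremsNonRelativizing) :
    fortnowRogers1999_thm42 :=
  h.2.1

/-- Projection: the Aaronson–Chen sampling oracle. [cite: AaronsonChen2017, Cor. 5.2] -/
theorem SupremacyTheoremsNonRelativizing.cor52 (h : SupremacyTheoremsNonRelativizing) :
    aaronsonChen2017_cor52 :=
  h.2.2

/-! ### The no-go theorems (proved) -/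

/-- **Template (a) does not relativize**: `O ↦ (BQP^O ⊆ BPP^O → PH^O collapses)` — here with
"collapses" as weak as `¬ IsInfinitePHRel O` — fails at the Fortnow–Rogers oracle, for every
oracle-indexed presentation `C` of `BQP^·` (`C (ofLanguage A) = BQPRel A`), given the tree fact
`PRel_subset_BPPRel : P^O ⊆ BPP^O`. [cite: FortnowRogers1999JCSS, Cor. 3.7 (arXiv numbering)] [cite: AroraBarakCC2009, Thm. 3.7 and p. 74] -/
theorem not_relativizes_collapse_template (h : fortnowRogers1999_cor37)
    (hPB : PRel_subset_BPPRel) {C : Oracle → Set (Language Bool)} (hC : PresentsBQPRel C) :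
    ¬ Relativizes fun O => C O ⊆ BPPRel O → ¬ IsInfinitePHRel O := by
  obtain ⟨A, hA, hPH⟩ := h
  intro hrel
  refine hrel A ?_ hPH
  rw [hC A, ← hA]
  exact hPB _

/-- The same with the literal collapse conclusion "`BQP^O = BPP^O`"-free form used unrelativized:
`O ↦ (C O ⊆ BPPRel O → ∃ k, SigmaPRel O k = SigmaPRel O (k + 1))` does not relativize.
[cite: FortnowRogers1999JCSS, Cor. 3.7 (arXiv numbering)] -/
theorem not_relativizes_collapse_template' (h : fortnowRogers1999_cor37)
    (hPB : PRel_subset_BPPRel) {C : Oracle → Set (Language Bool)} (hC : PresentsBQPRel C) :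
    ¬ Relativizes fun O => C O ⊆ BPPRel O → ∃ k, SigmaPRel O k = SigmaPRel O (k + 1) := by
  intro hrel
  refine not_relativizes_collapse_template h hPB hC fun A hsub hinf => ?_
  obtain ⟨k, hk⟩ := hrel A hsub
  exact hinf k hk

/-- **Template (b) does not relativize** (Aaronson–Chen: strong supremacy theorems must be
non-relativizing): `O ↦ (SampBQP^O ⊆ SampBPP^O → PH^O collapses)` fails at `O' = TQBF ⊕ O`, for
every oracle-indexed presentation `S` of `SampBQP^·`. [cite: AaronsonChen2017, Cor. 5.2 and §1 p. 8] -/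
theorem not_relativizes_sampling_collapse_template (h : aaronsonChen2017_cor52)
    {S : Oracle → Set SamplingProblem} (hS : PresentsSampBQPRel S) :
    ¬ Relativizes fun O => S O ⊆ SampPRel O → ¬ IsInfinitePHRel O := by
  obtain ⟨A, hA, hPH⟩ := h
  intro hrel
  refine hrel A ?_ hPH
  rw [hS A, ← hA]

/-- **Template (c) does not relativize** (Fortnow–Rogers: "one-way functions ⟹ `BPP ≠ BQP`"
needs non-relativizing techniques): `O ↦ (P^O ≠ UP^O ∩ coUP^O → BQP^O ⊄ BPP^O)` fails at the
oracle `C` of Thm. 4.2, for every presentation of `BQP^·`. [cite: FortnowRogers1999JCSS, Thm. 4.1 and Thm. 4.2 (arXiv numbering)] -/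
theorem not_relativizes_owf_template (h : fortnowRogers1999_thm42)
    {C : Oracle → Set (Language Bool)} (hC : PresentsBQPRel C) :
    ¬ Relativizes fun O => PRel O ≠ UPRel O ∩ coUPRel O → ¬ C O ⊆ BPPRel O := by
  obtain ⟨A, hPB, hBQ, hUP⟩ := h
  intro hrel
  refine hrel A hUP ?_
  rw [hC A, ← hBQ]

/-- All three at once from the barrier fact. [cite: FortnowRogers1999JCSS, Cor. 3.7, Thm. 4.2 (arXiv numbering)] [cite: AaronsonChen2017, Cor. 5.2] -/
theorem SupremacyTheoremsNonRelativizing.summary (h : SupremacyTheoremsNonRelativizing)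
    (hPB : PRel_subset_BPPRel) {C : Oracle → Set (Language Bool)} (hC : PresentsBQPRel C)
    {S : Oracle → Set SamplingProblem} (hS : PresentsSampBQPRel S) :
    (¬ Relativizes fun O => C O ⊆ BPPRel O → ¬ IsInfinitePHRel O) ∧
      (¬ Relativizes fun O => S O ⊆ SampPRel O → ¬ IsInfinitePHRel O) ∧
        ¬ Relativizes fun O => PRel O ≠ UPRel O ∩ coUPRel O → ¬ C O ⊆ BPPRel O :=
  ⟨not_relativizes_collapse_template h.cor37 hPB hC,
    not_relativizes_sampling_collapse_template h.cor52 hS,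
    not_relativizes_owf_template h.thm42 hC⟩

/-- The summary for the canonical presentations `bqpRelOf`, `sampBQPRelOf`: no presentation
hypothesis left besides the barrier fact and the tree fact `P^O ⊆ BPP^O`.
[cite: FortnowRogers1999JCSS, Cor. 3.7, Thm. 4.2 (arXiv numbering)] [cite: AaronsonChen2017, Cor. 5.2] -/
theorem SupremacyTheoremsNonRelativizing.summary_canonical (h : SupremacyTheoremsNonRelativizing)
    (hPB : PRel_subset_BPPRel) :
    (¬ Relativizes fun O => bqpRelOf O ⊆ BPPRel O → ¬ IsInfinitePHRel O) ∧
      (¬ Relativizes fun O => sampBQPRelOf O ⊆ SampPRel O → ¬ IsInfinitePHRel O) ∧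
        ¬ Relativizes fun O => PRel O ≠ UPRel O ∩ coUPRel O → ¬ bqpRelOf O ⊆ BPPRel O :=
  h.summary hPB presentsBQPRel_bqpRelOf presentsSampBQPRel_sampBQPRelOf

/-- The Fortnow–Rogers oracle also witnesses, once more, the collapsing half of the plain
relativization barrier: `BQP^A ⊆ BPP^A` for some `A` (compare the tree fact
`Literature.Computability.QuantumComplexity.exists_oracle_BQPRel_subset_BPPRel`). [cite: FortnowRogers1999JCSS, Cor. 3.7 (arXiv numbering)] -/
theorem exists_oracle_BQPRel_subset_BPPRel_of_cor37 (h : fortnowRogers1999_cor37)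
    (hPB : PRel_subset_BPPRel) :
    ∃ A : Language Bool, BQPRel A ⊆ BPPRel (Oracle.ofLanguage A) := by
  obtain ⟨A, hA, -⟩ := h
  exact ⟨A, hA ▸ hPB _⟩

end Literature.Barriers.QuantumAdvantage

end
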